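import Summits.BirchSwinnertonDyer.BirchSwinnertonDyer.Theses.SemiOrdinaryEisensteinDescent
import HarnessLib

/-!
# Route `SemiOrdinaryEisensteinDescent` — assembly item `Assembly` (stmt-BirchSwinnertonDyer-20486):
# pure logic (the shape of the route's `closes`)

`Assembly` = `PublishedInputsWildThree → WildSplitEisensteinInclusionAtThree → WildKolyvaginUpperAtThree →
WildSplitWaldspurgerAtThree → WildSplitControlAtThree → WildRankZeroTwistAtThree →
WildRankOneSurjNonTowerAtThree → EisensteinKernelAtThree → WAllExclAddWildRankOneSurj`: apply the
kernel to the seven inputs — verbatim the route's deciding theorem `closes` (planner bsd-wall-pss3 g4).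
HONEST FRAMING: pure logic; the kernel and every crux are ANTECEDENTS; BSD is not advanced by this.
Prover seat bsd-wall-bed-p3 (g1), 2026-08-27.

References: [JetchevSkinnerWan2017] §7.4; [Jetchev2008] Thm. 1.4.
-/

set_option linter.dupNamespace false

namespace Summit.BirchSwinnertonDyer.BirchSwinnertonDyer.Theorems.SemiOrdinaryEisensteinDescentAssembly

open Summit.BirchSwinnertonDyer.BirchSwinnertonDyer.Theses.SemiOrdinaryEisensteinDescent

/-- **Assembly (item 20486) holds**: the kernel applied to the published inputs and the six cruxes
(= the route's `closes`). [cite: JetchevSkinnerWan2017, §7.4.1 (arXiv:1512.06894 p. 30)] -/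
theorem assembly_proof : Assembly := by
  unfold Assembly
  intro hIn hE hKo hV hC hZ hNT hK
  exact hK hIn hE hKo hV hC hZ hNT

end Summit.BirchSwinnertonDyer.BirchSwinnertonDyer.Theorems.SemiOrdinaryEisensteinDescentAssembly
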